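import Summits.CriticalPhenomena.CardyFormulaZ2.Theorems.CardyWhiteToColouredNoiseDiscretisationVariance
import Summits.CriticalPhenomena.CardyFormulaZ2.Theorems.CardyWhiteToColouredNoiseDiscretisationWhiteNoise

/-!
# Tail of the coupling discrepancy at one point

Helper file for item `NoiseDiscretisation` (stmt-CriticalPhenomena-4598) of route
`CardyWhiteToColoured` (`CardyFormulaZ2`). Fix `0 < δ ≤ ℓ`, `0 < θ < 1`, a one-dimensional bump
`β` (plateau radius `(1 − θ)δ/2`, support radius `(1 − θ/2)δ/2`), Schwartz functions `H e` with
values the cell bumps `hB[β, m_δ(e), ·]` and a white noise `μ`. At a point `x`, the discrepancy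
`Δ(ω) = ∑'_{e} K(x − m_δ(e)) ω(H e) − ω(k_x)` (`K = gaussWeight ℓ`, `k_x` the Gaussian bump of
the route at `x`) between the (rescaled) smoothed lattice noise `ξ_e = ω(H e)/N` and the smoothed
continuum noise satisfies the Gaussian tail bound
`μ{η ≤ |Δ|} ≤ 2 exp(−η²/(8 (27 δ² + 120 θ ℓ²)))` (`measure_discrepancy_ge_le`):

* the lattice sum of the kernel `∑_e K(x − m_δ(e))` converges (cells: `K(x − m_e)` is dominated
  by the average over the open cell of `e` of a Gaussian envelope), so `∑_e K(x − m_e) |ω(H e)|`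
  has finite expectation and the series defining `Δ` converges absolutely for a.e. `ω`;
* for such `ω`, `Δ(ω)` is the limit along an exhaustion `s_n ↑ E(ℤ²)` of `ω(f_n)` with
  `f_n = ∑_{e ∈ s_n} K(x − m_e) • H e − k_x ∈ 𝓢`, a centred Gaussian of variance `∫ f_n²`, which
  is eventually `≤ 27 δ² + 120 θ ℓ²` (`integral_sq_partial_le_eventually`); the two-sided Chernoff
  bound for `ω(f_n)` passes to the limit through `{η ≤ |Δ|} ⊆ liminf {η/2 < |ω(f_n)|}`.

References: S. Muirhead, H. Vanneuville, Ann. Inst. H. Poincaré Probab. Stat. 56 (2020), §3.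
-/

noncomputable section

namespace Summit.CriticalPhenomena.CardyFormulaZ2.Theorems

namespace WhiteToColoured

open Set Metric MeasureTheory Filter Topology Real ENNReal Finset ProbabilityTheory
open Literature.Probability.LatticeModels Literature.Probability.Percolation
open Literature.MathematicalPhysics.QuantumLattice

/-- `Dg[w] = max |Re w + Im w| |Re w − Im w| = |Re w| + |Im w|`, the rotated sup-distance. -/
local notation3 "Dg[" w "]" => max |Complex.re w + Complex.im w| |Complex.re w - Complex.im w|

/-- The value `hB[β, m, z] = β (p (z − m)) · β (q (z − m))` of the cell bump built from a
one-dimensional bump `β` and centred at `m`. -/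
local notation3 "hB[" β ", " m ", " z "]" =>
  (β : ℝ → ℝ) (Complex.re (z - m) + Complex.im (z - m)) * β (Complex.re (z - m) - Complex.im (z - m))

/-! ### The lattice sum of the Gaussian kernel converges -/

/-- **`K(x − m)` is dominated by a Gaussian envelope at nearby points**: for `‖y − m‖ ≤ d ≤ ℓ`,
`K(x − m) ≤ √e · exp(−‖y − x‖²/(4ℓ²))`. -/
theorem gaussWeight_le_of_norm_sub_le {ℓ d : ℝ} (hℓ : 0 < ℓ) (hd : 0 ≤ d) (hdℓ : d ≤ ℓ)
    {x m y : ℂ} (hym : ‖y - m‖ ≤ d) :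
    gaussWeight ℓ (x - m) ≤ Real.exp (1 / 2) * Real.exp (-‖y - x‖ ^ 2 / (4 * ℓ ^ 2)) := by
  have h := gaussWeight_sq_le_of_norm_sub_le hℓ hd hdℓ (x := x) hym
  rw [gaussWeight_sub_comm] at h
  have hsq : (Real.exp (1 / 2) * Real.exp (-‖y - x‖ ^ 2 / (4 * ℓ ^ 2))) ^ 2 =
      Real.exp 1 * Real.exp (-‖y - x‖ ^ 2 / (2 * ℓ ^ 2)) := by
    rw [mul_pow, ← Real.exp_nat_mul, ← Real.exp_nat_mul]
    congr 1
    · congr 1; push_cast; ring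
    · congr 1; push_cast; ring
  rw [← hsq] at h
  exact (pow_le_pow_iff_left₀ (gaussWeight_pos ℓ _).le (by positivity) two_ne_zero).1 h

/-- **The lattice sum of the Gaussian kernel converges** (as an extended real):
`∑'_{e ∈ E(ℤ²)} K(x − m_δ(e)) < ⊤`. -/
theorem tsum_ofReal_gaussWeight_medial_ne_top {ℓ δ : ℝ} (hℓ : 0 < ℓ) (hδ : 0 < δ) (hδℓ : δ ≤ ℓ)
    (x : ℂ) :
    ∑' e : (zdGraph 2).edgeSet, ENNReal.ofReal (gaussWeight ℓ (x - medialPoint δ e.1)) ≠ ⊤ := by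
  set C : (zdGraph 2).edgeSet → Set ℂ := fun e => {y : ℂ | Dg[y - medialPoint δ e.1] < δ / 2} with hC
  set G : ℂ → ℝ≥0∞ := fun y => ENNReal.ofReal (Real.exp (1 / 2) * Real.exp (-‖y - x‖ ^ 2 / (4 * ℓ ^ 2)))
    with hG
  set V : ℝ≥0∞ := ENNReal.ofReal ((δ / 2) ^ 2) * volume {w : ℂ | Dg[w] < 1} with hV
  have hV0 : V ≠ 0 := mul_ne_zero (by positivity) volume_unitCell_pos.ne'
  have hVtop : V ≠ ⊤ := ENNReal.mul_ne_top ENNReal.ofReal_ne_top volume_unitCell_lt_top.ne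
  have hvol : ∀ e : (zdGraph 2).edgeSet, volume (C e) = V := fun e => volume_cell _ (by positivity)
  -- per cell: `vol(C_e) K(x - m_e) ≤ ∫_{C_e} G`
  have hcell : ∀ e : (zdGraph 2).edgeSet, V * ENNReal.ofReal (gaussWeight ℓ (x - medialPoint δ e.1)) ≤
      ∫⁻ y in C e, G y := by
    intro e
    rw [← hvol e, mul_comm, ← setLIntegral_const]
    refine setLIntegral_mono' (isOpen_cell _ _).measurableSet fun y hy => ?_
    apply ENNReal.ofReal_le_ofReal
    refine gaussWeight_le_of_norm_sub_le hℓ (by positivity : (0 : ℝ) ≤ δ / 2) (by linarith) ?_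
    have : Dg[y - medialPoint δ e.1] < δ / 2 := hy
    exact (norm_le_dg _).trans this.le
  have hsum : V * ∑' e : (zdGraph 2).edgeSet, ENNReal.ofReal (gaussWeight ℓ (x - medialPoint δ e.1)) ≤
      ENNReal.ofReal (Real.exp (1 / 2) * (π * (4 * ℓ ^ 2))) := by
    calc V * ∑' e : (zdGraph 2).edgeSet, ENNReal.ofReal (gaussWeight ℓ (x - medialPoint δ e.1))
        = ∑' e : (zdGraph 2).edgeSet, V * ENNReal.ofReal (gaussWeight ℓ (x - medialPoint δ e.1)) :=
          ENNReal.tsum_mul_left.symm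
      _ ≤ ∑' e : (zdGraph 2).edgeSet, ∫⁻ y in C e, G y := ENNReal.tsum_le_tsum hcell
      _ = ∫⁻ y in ⋃ e : (zdGraph 2).edgeSet, C e, G y := by
          rw [lintegral_iUnion (fun e => (isOpen_cell _ _).measurableSet)]
          intro e e' hne
          exact disjoint_cell hδ e.2 e'.2 fun h => hne (Subtype.ext h)
      _ ≤ ∫⁻ y, G y := lintegral_mono_set (Set.subset_univ _) |>.trans (by rw [Measure.restrict_univ])
      _ = ENNReal.ofReal (Real.exp (1 / 2) * (π * (4 * ℓ ^ 2))) := by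
          rw [hG]
          simp_rw [ENNReal.ofReal_mul (Real.exp_pos _).le]
          rw [lintegral_const_mul _ (by fun_prop), lintegral_exp_neg_sq_norm_sub_div (by positivity) x,
            ← ENNReal.ofReal_mul (Real.exp_pos _).le]
  intro htop
  rw [htop, ENNReal.mul_top hV0] at hsum
  exact absurd hsum (by simp)

/-- **The lattice sum of the Gaussian kernel converges** (real summability). -/
theorem summable_gaussWeight_medial {ℓ δ : ℝ} (hℓ : 0 < ℓ) (hδ : 0 < δ) (hδℓ : δ ≤ ℓ) (x : ℂ) :
    Summable fun e : (zdGraph 2).edgeSet => gaussWeight ℓ (x - medialPoint δ e.1) := by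
  have h := tsum_ofReal_gaussWeight_medial_ne_top hℓ hδ hδℓ x
  have h' : (∑' e : (zdGraph 2).edgeSet,
      ((gaussWeight ℓ (x - medialPoint δ e.1)).toNNReal : ℝ≥0∞)) ≠ ⊤ := by
    simpa only [ENNReal.ofReal] using h
  have hs := ENNReal.tsum_coe_ne_top_iff_summable.1 h'
  have hs' := NNReal.summable_coe.2 hs
  refine hs'.congr fun e => ?_
  exact Real.coe_toNNReal _ (gaussWeight_pos ℓ _).le

/-! ### Almost sure absolute convergence of the discrepancy series -/

section

variable {μ : Measure (FieldConfig ℂ)} {β : ℝ → ℝ} {ℓ δ θ : ℝ}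
  {H : (zdGraph 2).edgeSet → SchwartzMap ℂ ℝ}

/-- The first absolute moment of an evaluation is at most `1 + ∫ f²`. -/
theorem lintegral_enorm_eval_le (h : IsWhiteNoise μ) (f : SchwartzMap ℂ ℝ) :
    ∫⁻ ω : FieldConfig ℂ, ‖ω f‖ₑ ∂μ ≤ ENNReal.ofReal (1 + ∫ z, f z ^ 2) := by
  haveI := wn_isProbabilityMeasure h
  have hint : Integrable (fun ω : FieldConfig ℂ => 1 + (ω f) ^ 2) μ :=
    (integrable_const 1).add (wn_memLp_eval h f).integrable_sq
  calc ∫⁻ ω : FieldConfig ℂ, ‖ω f‖ₑ ∂μ ≤ ∫⁻ ω : FieldConfig ℂ, ENNReal.ofReal (1 + (ω f) ^ 2) ∂μ := by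
        refine lintegral_mono fun ω => ?_
        rw [Real.enorm_eq_ofReal_abs]
        apply ENNReal.ofReal_le_ofReal
        nlinarith [abs_nonneg (ω f), sq_abs (ω f), sq_nonneg (|ω f| - 1)]
    _ = ENNReal.ofReal (∫ ω : FieldConfig ℂ, 1 + (ω f) ^ 2 ∂μ) :=
        (ofReal_integral_eq_lintegral_ofReal hint (Eventually.of_forall fun ω => by positivity)).symm
    _ = ENNReal.ofReal (1 + ∫ z, f z ^ 2) := by
        rw [integral_add (integrable_const 1) (wn_memLp_eval h f).integrable_sq, integral_const,
          wn_integral_sq_eval h f]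
        simp

/-- **The discrepancy series converges absolutely for almost every configuration.** -/
theorem ae_summable_discrepancy (h : IsWhiteNoise μ) (hℓ : 0 < ℓ) (hδ : 0 < δ) (hδℓ : δ ≤ ℓ)
    (hH : ∀ e z, H e z = hB[β, medialPoint δ e.1, z]) (x : ℂ) :
    ∀ᵐ ω ∂μ, Summable fun e : (zdGraph 2).edgeSet =>
      gaussWeight ℓ (x - medialPoint δ e.1) * ω (H e) := by
  set N2 : ℝ := ∫ z, hB[β, 0, z] ^ 2 with hN2
  have hHsq : ∀ e : (zdGraph 2).edgeSet, ∫ z, (H e z) ^ 2 = N2 := by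
    intro e
    have : (fun z => (H e z) ^ 2) = fun z => hB[β, medialPoint δ e.1, z] ^ 2 := by
      funext z; rw [hH]
    rw [this]
    exact integral_hB_sq (β := β) (medialPoint δ e.1)
  -- the expectation of the sum of absolute values is finite
  set Y : FieldConfig ℂ → ℝ≥0∞ := fun ω => ∑' e : (zdGraph 2).edgeSet, ‖gaussWeight ℓ (x - medialPoint δ e.1) * ω (H e)‖ₑ
    with hY
  have hmeas : ∀ e : (zdGraph 2).edgeSet, Measurable fun ω : FieldConfig ℂ =>
      ‖gaussWeight ℓ (x - medialPoint δ e.1) * ω (H e)‖ₑ := fun e =>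
    (measurable_const.mul (measurable_eval (H e))).enorm
  have hYm : Measurable Y := Measurable.tsum hmeas
  have hYint : ∫⁻ ω, Y ω ∂μ ≠ ⊤ := by
    rw [hY, lintegral_tsum fun e => (hmeas e).aemeasurable]
    have hle : ∀ e : (zdGraph 2).edgeSet, ∫⁻ ω : FieldConfig ℂ, ‖gaussWeight ℓ (x - medialPoint δ e.1) * ω (H e)‖ₑ ∂μ ≤
        ENNReal.ofReal (gaussWeight ℓ (x - medialPoint δ e.1)) * ENNReal.ofReal (1 + N2) := by
      intro e
      have : (fun ω : FieldConfig ℂ => ‖gaussWeight ℓ (x - medialPoint δ e.1) * ω (H e)‖ₑ) =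
          fun ω => ENNReal.ofReal (gaussWeight ℓ (x - medialPoint δ e.1)) * ‖ω (H e)‖ₑ := by
        funext ω
        rw [enorm_mul, Real.enorm_eq_ofReal (gaussWeight_pos ℓ _).le]
      rw [this, lintegral_const_mul _ (measurable_eval (H e)).enorm, ← hHsq e]
      exact mul_le_mul' le_rfl (lintegral_enorm_eval_le h (H e))
    refine ne_top_of_le_ne_top ?_ (ENNReal.tsum_le_tsum hle)
    rw [ENNReal.tsum_mul_right]
    exact ENNReal.mul_ne_top (tsum_ofReal_gaussWeight_medial_ne_top hℓ hδ hδℓ x) ENNReal.ofReal_ne_top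
  filter_upwards [ae_lt_top hYm hYint] with ω hω
  have h1 : (∑' e : (zdGraph 2).edgeSet, ((‖gaussWeight ℓ (x - medialPoint δ e.1) * ω (H e)‖₊ : NNReal) : ℝ≥0∞)) ≠ ⊤ :=
    hω.ne
  have h2 := ENNReal.tsum_coe_ne_top_iff_summable.1 h1
  exact Summable.of_norm (NNReal.summable_coe.2 h2)

/-! ### The tail bound -/

/-- **Gaussian tail of the discrepancy at one point.** With `v = 27 δ² + 120 θ ℓ²`,
`μ{η ≤ |∑'_e K(x − m_e) ω(H e) − ω(k_x)|} ≤ 2 exp(−η²/(8 v))` for `η > 0`. -/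
theorem measureReal_discrepancy_ge_le (h : IsWhiteNoise μ) (hℓ : 0 < ℓ) (hδ : 0 < δ)
    (hδℓ : δ ≤ ℓ) (hθ0 : 0 < θ) (hθ1 : θ < 1) (hβ : ContDiff ℝ ((⊤ : ℕ∞) : WithTop ℕ∞) β)
    (hβ1' : ∀ w, |w| ≤ (1 - θ) * δ / 2 → β w = 1)
    (hβ0 : ∀ w, β w ≠ 0 → |w| < (1 - θ / 2) * δ / 2) (hβp : ∀ w, 0 ≤ β w) (hβ1 : ∀ w, β w ≤ 1)
    (hH : ∀ e z, H e z = hB[β, medialPoint δ e.1, z]) {k : ℝ → ℂ → SchwartzMap ℂ ℝ}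
    (hk : IsGaussianBumpFamily k) (x : ℂ) {η : ℝ} (hη : 0 < η) :
    μ.real {ω : FieldConfig ℂ | η ≤ |(∑' e : (zdGraph 2).edgeSet,
        gaussWeight ℓ (x - medialPoint δ e.1) * ω (H e)) - ω (k ℓ x)|} ≤
      2 * Real.exp (-η ^ 2 / (8 * (27 * δ ^ 2 + 120 * θ * ℓ ^ 2))) := by
  haveI := wn_isProbabilityMeasure h
  set v : ℝ := 27 * δ ^ 2 + 120 * θ * ℓ ^ 2 with hv
  have hvpos : 0 < v := by positivity
  -- an exhaustion of the edge set
  have hE0 : s((0 : Site 2), (0 : Site 2) + Pi.single (0 : Fin 2) (1 : ℤ)) ∈ (zdGraph 2).edgeSet :=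
    mem_edgeSet_zdGraph_iff.2 ⟨0, 0, rfl⟩
  haveI : Nonempty (zdGraph 2).edgeSet := ⟨⟨_, hE0⟩⟩
  obtain ⟨f, hf⟩ := exists_surjective_nat (zdGraph 2).edgeSet
  set s : ℕ → Finset (zdGraph 2).edgeSet := fun n => (Finset.range (n + 1)).image f with hs
  have hmono : Monotone s := fun a b hab =>
    Finset.image_subset_image (Finset.range_mono (by omega))
  have hex : ∀ e, ∃ n, e ∈ s n := fun e => by
    obtain ⟨n, rfl⟩ := hf e
    exact ⟨n, Finset.mem_image.2 ⟨n, Finset.mem_range.2 (by omega), rfl⟩⟩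
  have hstend : Tendsto s atTop atTop := tendsto_atTop_finset_of_monotone hmono hex
  -- the test functions of the partial sums
  set g : ℕ → SchwartzMap ℂ ℝ := fun n =>
    ∑ e ∈ s n, gaussWeight ℓ (x - medialPoint δ e.1) • H e - k ℓ x with hg
  have hg_apply : ∀ n (ω : FieldConfig ℂ), ω (g n) =
      ∑ e ∈ s n, gaussWeight ℓ (x - medialPoint δ e.1) * ω (H e) - ω (k ℓ x) := by
    intro n ω
    rw [hg, map_sub, map_sum]
    simp only [map_smul, smul_eq_mul]
  have hg_val : ∀ n z, g n z = ∑ e ∈ s n, gaussWeight ℓ (x - medialPoint δ e.1) *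
      hB[β, medialPoint δ e.1, z] - gaussWeight ℓ (z - x) := by
    intro n z
    rw [hg, sub_apply, _root_.sum_apply, hk.apply_eq_gaussWeight hℓ]
    simp only [smul_apply, smul_eq_mul, hH]
  -- eventually the variance is at most `v`
  have hvar : ∀ᶠ n in atTop, ∫ z, (g n z) ^ 2 ≤ v := by
    have := integral_sq_partial_le_eventually hℓ hδ hδℓ hθ0 hθ1 hβ hβ1' hβ0 hβp hβ1 x hmono hex
      (ε := δ ^ 2) (by positivity)
    filter_upwards [this] with n hn
    simp_rw [hg_val]
    rw [hv]
    linarith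
  obtain ⟨N₀, hN₀⟩ := eventually_atTop.1 hvar
  -- Chernoff for the partial sums
  have hB : ∀ n, N₀ ≤ n → μ.real {ω : FieldConfig ℂ | η / 2 ≤ |ω (g n)|} ≤
      2 * Real.exp (-(η / 2) ^ 2 / (2 * v)) := fun n hn =>
    wn_measureReal_abs_eval_ge_le h (g n) hvpos (hN₀ n hn) (by positivity)
  -- the good set and the limsup-type inclusion
  set S : Set (FieldConfig ℂ) := {ω | η ≤ |(∑' e : (zdGraph 2).edgeSet,
    gaussWeight ℓ (x - medialPoint δ e.1) * ω (H e)) - ω (k ℓ x)|} with hS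
  set A : Set (FieldConfig ℂ) := {ω | Summable fun e : (zdGraph 2).edgeSet =>
    gaussWeight ℓ (x - medialPoint δ e.1) * ω (H e)} with hA
  set B : ℕ → Set (FieldConfig ℂ) := fun n => {ω | η / 2 ≤ |ω (g n)|} with hBdef
  set D : ℕ → Set (FieldConfig ℂ) := fun M => ⋂ n, ⋂ (_ : M ≤ n), B n with hD
  have hSA : S ∩ A ⊆ ⋃ M, D M := by
    rintro ω ⟨hωS, hωA⟩
    have hlim : Tendsto (fun n => ω (g n)) atTop
        (𝓝 ((∑' e : (zdGraph 2).edgeSet, gaussWeight ℓ (x - medialPoint δ e.1) * ω (H e)) -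
          ω (k ℓ x))) := by
      simp_rw [hg_apply]
      exact ((Summable.hasSum hωA).comp hstend).sub_const _
    have hev : ∀ᶠ n in atTop, η / 2 < |ω (g n)| := by
      have habs := (continuous_abs.tendsto _).comp hlim
      have hgt : η / 2 < |(∑' e : (zdGraph 2).edgeSet,
          gaussWeight ℓ (x - medialPoint δ e.1) * ω (H e)) - ω (k ℓ x)| := by
        have : η ≤ _ := hωS
        linarith
      exact habs (Ioi_mem_nhds hgt)
    obtain ⟨M, hM⟩ := eventually_atTop.1 hev
    refine mem_iUnion.2 ⟨M, mem_iInter₂.2 fun n hn => ?_⟩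
    exact (hM n hn).le
  have hDmono : Monotone D := fun M M' hMM' ω hω => by
    simp only [hD, mem_iInter] at hω ⊢
    exact fun n hn => hω n (hMM'.trans hn)
  have hDle : ∀ M, μ (D M) ≤ ENNReal.ofReal (2 * Real.exp (-(η / 2) ^ 2 / (2 * v))) := by
    intro M
    have hsub : D M ⊆ B (max M N₀) := fun ω hω => by
      simp only [hD, mem_iInter] at hω
      exact hω _ (le_max_left _ _)
    calc μ (D M) ≤ μ (B (max M N₀)) := measure_mono hsub
      _ = ENNReal.ofReal (μ.real (B (max M N₀))) := (ofReal_measureReal (measure_ne_top _ _)).symm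
      _ ≤ ENNReal.ofReal (2 * Real.exp (-(η / 2) ^ 2 / (2 * v))) :=
          ENNReal.ofReal_le_ofReal (hB _ (le_max_right _ _))
  have hAc : μ Aᶜ = 0 := by
    have := ae_summable_discrepancy h hℓ hδ hδℓ hH x (β := β)
    rw [ae_iff] at this
    rw [hA]
    exact this
  -- conclusion
  have hSle : μ S ≤ ENNReal.ofReal (2 * Real.exp (-(η / 2) ^ 2 / (2 * v))) := by
    calc μ S ≤ μ (S ∩ A ∪ Aᶜ) := measure_mono fun ω hω => by
          by_cases hA' : ω ∈ A
          · exact Or.inl ⟨hω, hA'⟩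
          · exact Or.inr hA'
      _ ≤ μ (S ∩ A) + μ Aᶜ := measure_union_le _ _
      _ ≤ μ (⋃ M, D M) + 0 := by rw [hAc]; exact add_le_add (measure_mono hSA) le_rfl
      _ = ⨆ M, μ (D M) := by rw [add_zero, hDmono.measure_iUnion]
      _ ≤ ENNReal.ofReal (2 * Real.exp (-(η / 2) ^ 2 / (2 * v))) := iSup_le hDle
  have heq : -(η / 2) ^ 2 / (2 * v) = -η ^ 2 / (8 * v) := by
    field_simp
    ring
  rw [heq] at hSle
  calc μ.real S = (μ S).toReal := rfl
    _ ≤ (ENNReal.ofReal (2 * Real.exp (-η ^ 2 / (8 * v)))).toReal :=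
        ENNReal.toReal_mono ENNReal.ofReal_ne_top hSle
    _ = 2 * Real.exp (-η ^ 2 / (8 * v)) := ENNReal.toReal_ofReal (by positivity)

end

end WhiteToColoured

end Summit.CriticalPhenomena.CardyFormulaZ2.Theorems
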